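import Literature.NumberTheory.Connes2026.AnnulusTraceValue
import Literature.NumberTheory.Connes2026.AnnulusValueReduction
import Literature.NumberTheory.Connes2026.AnnulusFamilyReduction
import HarnessLib

/-!
# Connes 1999 Thm VII.4, `k = ℚ`, `S = {∞, p}` — hypothesis (V) DISCHARGED: the fact at `P = {p}` now follows
# from the off-shell remainder estimates (O1), (O0), (O2) alone

LABEL (line 1): RH-FREE literature (theorems only; NO definition, NO named fact).  bears_on: LADDER-RH
W-C/W-P (C1 named-fact debt), cell `rh-crit`, sub-cell cc, overflow row O1 — the "annulus road" under
`Connes1999_thm_VII_4_rat`.  WHAT THIS IS NOT: a discharge of the fact; any claim about positivity, Weil's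
criterion or RH.

Sources.  A. Connes, Selecta Math. 5 (1999) [`Connes1999`], §VII Thm 4 and proof (29)–(33) (held text
`paper:arxiv-math_9811068`, p0013).

## What is proved

* `traceValue_translate` — `Σ_{ev basis} ⟨e_i, ϑ(g(· − s)) Q_{1/p,1} e_i⟩ = log p · g(−s)` for a Weil test function `g`
  (`AnnulusTraceValue.tsum_inner_scalingOp_shellProj_eq_log_mul` at `(a, b) = (1/p, 1)`, `h = g(· − s)`);
* **`annulusValue`** — hypothesis (V) of `Connes1999_thm_VII_4_rat_singleton_of_offShell`:
  `Σ_i ⟨f_i, (ϑ(g) ∘ Q₀ ∘ (Q₀ ∘ ϑ_{m log p})) f_i⟩ = log p · g(−m log p)`;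
* **`Connes1999_thm_VII_4_rat_singleton_of_offShell'`** — the conclusion of `Connes1999_thm_VII_4_rat` at
  `P = {p}` from (O1), (O0), (O2) only (uniform absolute bound, basis independence and vanishing limit of the
  diagonal series of the OFF-SHELL remainder `ϑ(g)(1 − Q₀) P̂⁰_M Q₀ ϑ_{m log p}`).

No instance, notation or attribute; no `def`.
-/

noncomputable section

open _root_.MeasureTheory Complex Set Filter
open scoped Real Topology ComplexConjugate InnerProductSpace ContDiff

namespace Literature.NumberTheory.Connes2026

open Literature.NumberTheory.LFunctions Literature.Analysis.OperatorTheory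
open Literature.NumberTheory.ConnesConsani
open Literature.NumberTheory.ConnesConsani2024
open Literature.NumberTheory.ConnesConsani2021 hiding cutoffProj cutoffProj_coeFn

variable (p : ℕ) [hp : Fact p.Prime]

/-- **`Σ_{ev basis} ⟨e_i, ϑ(g(· − s)) Q_{1/p, 1} e_i⟩ = log p · g(−s)`** for a Weil test function `g`. [cite: Connes1999, §VII proof of Thm 4 eqs. (29)–(33) (arXiv p0013)] -/
theorem traceValue_translate {g : ℝ → ℂ} (hg : IsWeilTest g) (s : ℝ) (ι : Type)
    (e : HilbertBasis ι ℂ (evenPart : Submodule ℂ (Lp ℂ 2 (volume : Measure ℝ)))) :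
    ∑' i, ⟪((e i : evenPart) : Lp ℂ 2 (volume : Measure ℝ)),
        (scalingOp (fun τ => g (τ - s)) ∘L shellProj (p : ℝ)⁻¹ 1) ((e i : evenPart) : Lp ℂ 2 (volume : Measure ℝ))⟫_ℂ =
      (Real.log p : ℂ) * g (-s) := by
  have hh : ContDiff ℝ ∞ (fun τ => g (τ - s)) := hg.1.comp (contDiff_id.sub contDiff_const)
  have hhs : HasCompactSupport (fun τ => g (τ - s)) := hg.2.comp_homeomorph (Homeomorph.subRight s)
  have hp1 : (1 : ℝ) < p := by exact_mod_cast hp.out.one_lt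
  have ha : (0 : ℝ) < (p : ℝ)⁻¹ := inv_pos.mpr (by linarith)
  have hab : (p : ℝ)⁻¹ ≤ 1 := inv_le_one_of_one_le₀ hp1.le
  rw [(tsum_inner_scalingOp_shellProj_eq_log_mul hh hhs ha hab e).2, one_div, inv_inv, zero_sub]

/-- **Hypothesis (V) of `Connes1999_thm_VII_4_rat_singleton_of_offShell`, discharged**:
`Σ_i ⟨f_i, (ϑ(g) ∘ Q₀ ∘ (Q₀ ∘ ϑ_{m log p})) f_i⟩ = log p · g(−m log p)` for every Weil test function `g`, `m ∈ ℤ`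
and every Hilbert basis of `L²(ℝ)_ev`. [cite: Connes1999, §VII proof of Thm 4 eqs. (29)–(33) (arXiv p0013)] -/
theorem annulusValue {g : ℝ → ℂ} (hg : IsWeilTest g) (m : ℤ) (ι : Type)
    (f : HilbertBasis ι ℂ (evenPart : Submodule ℂ (Lp ℂ 2 (volume : Measure ℝ)))) :
    ∑' i, ⟪((f i : evenPart) : Lp ℂ 2 (volume : Measure ℝ)),
        (scalingOp g ∘L (shellProj (p : ℝ)⁻¹ 1 ∘L (annulusProj p 1 ∘L scalingUnitary (m * Real.log p))))
          ((f i : evenPart) : Lp ℂ 2 (volume : Measure ℝ))⟫_ℂ = (Real.log p : ℂ) * g (-(m * Real.log p)) :=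
  annulusValue_of_traceValue p (hg.1.continuous.integrable_of_hasCompactSupport hg.2)
    (fun s ι e => traceValue_translate p hg s ι e) m ι f

/-- **Connes 1999 Thm VII.4 (`k = ℚ`) at `P = {p}` from the off-shell remainder alone**: if the diagonal series of
`ϑ(g)(1 − Q₀) P̂⁰_M Q₀ ϑ_{m log p}` along Hilbert bases of `L²(ℝ)_ev` are (O1) absolutely summable with sums bounded
uniformly in `(M, m, basis)`, (O0) basis independent, and (O2) tend to `0` as `M → ∞`, then for every Hilbert basis
`Σ_i ⟨b_i|ϑ(g)R_Λ|b_i⟩ − (2g(0) log Λ + arch(g)) → ∫′_{ℚ_p^*} g(|u|)|1−u|⁻¹ d^*u` — the trace value (V) being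
`annulusValue`. [cite: Connes1999, §VII Thm 4 and proof eqs. (29)–(33) (arXiv p0013)] -/
theorem Connes1999_thm_VII_4_rat_singleton_of_offShell' {g : ℝ → ℂ} (hg : IsWeilTest g) {C' : ℝ}
    (hO1 : ∀ (M : ℝ) (m : ℤ) (ι : Type)
      (f : HilbertBasis ι ℂ (evenPart : Submodule ℂ (Lp ℂ 2 (volume : Measure ℝ)))),
      Summable (fun i => ‖⟪((f i : evenPart) : Lp ℂ 2 (volume : Measure ℝ)),
        (scalingOp g ∘L ((1 - shellProj (p : ℝ)⁻¹ 1) ∘L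
          (dualCutoffProj ∅ M ∘L (annulusProj p 1 ∘L scalingUnitary (m * Real.log p)))))
          ((f i : evenPart) : Lp ℂ 2 (volume : Measure ℝ))⟫_ℂ‖) ∧
      ∑' i, ‖⟪((f i : evenPart) : Lp ℂ 2 (volume : Measure ℝ)),
        (scalingOp g ∘L ((1 - shellProj (p : ℝ)⁻¹ 1) ∘L
          (dualCutoffProj ∅ M ∘L (annulusProj p 1 ∘L scalingUnitary (m * Real.log p)))))
          ((f i : evenPart) : Lp ℂ 2 (volume : Measure ℝ))⟫_ℂ‖ ≤ C')
    (hO0 : ∀ (M : ℝ) (m : ℤ) (ι : Type)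
      (f : HilbertBasis ι ℂ (evenPart : Submodule ℂ (Lp ℂ 2 (volume : Measure ℝ)))) (ι' : Type)
      (f' : HilbertBasis ι' ℂ (evenPart : Submodule ℂ (Lp ℂ 2 (volume : Measure ℝ)))),
      ∑' i, ⟪((f i : evenPart) : Lp ℂ 2 (volume : Measure ℝ)),
        (scalingOp g ∘L ((1 - shellProj (p : ℝ)⁻¹ 1) ∘L
          (dualCutoffProj ∅ M ∘L (annulusProj p 1 ∘L scalingUnitary (m * Real.log p)))))
          ((f i : evenPart) : Lp ℂ 2 (volume : Measure ℝ))⟫_ℂ =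
      ∑' i, ⟪((f' i : evenPart) : Lp ℂ 2 (volume : Measure ℝ)),
        (scalingOp g ∘L ((1 - shellProj (p : ℝ)⁻¹ 1) ∘L
          (dualCutoffProj ∅ M ∘L (annulusProj p 1 ∘L scalingUnitary (m * Real.log p)))))
          ((f' i : evenPart) : Lp ℂ 2 (volume : Measure ℝ))⟫_ℂ)
    (hO2 : ∀ (m : ℤ) (ι : Type) (f : HilbertBasis ι ℂ (evenPart : Submodule ℂ (Lp ℂ 2 (volume : Measure ℝ)))),
      Tendsto (fun M : ℝ => ∑' i, ⟪((f i : evenPart) : Lp ℂ 2 (volume : Measure ℝ)),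
        (scalingOp g ∘L ((1 - shellProj (p : ℝ)⁻¹ 1) ∘L
          (dualCutoffProj ∅ M ∘L (annulusProj p 1 ∘L scalingUnitary (m * Real.log p)))))
          ((f i : evenPart) : Lp ℂ 2 (volume : Measure ℝ))⟫_ℂ) atTop (𝓝 0))
    (ι : Type) (b : HilbertBasis ι ℂ (evenPart : Submodule ℂ (Lp ℂ 2 (volume : Measure ℝ)))) :
    (∀ Λ : ℝ, 0 < Λ →
      Summable fun i => diagCoeff g (cutoffR {p} Λ) ((b i : evenPart) : Lp ℂ 2 (volume : Measure ℝ))) ∧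
    Tendsto (fun Λ : ℝ =>
        (∑' i, diagCoeff g (cutoffR {p} Λ) ((b i : evenPart) : Lp ℂ 2 (volume : Measure ℝ)))
          - connesSemilocalGeometricSide {p} Λ g)
      atTop (𝓝 0) :=
  Connes1999_thm_VII_4_rat_singleton_of_offShell p hg hO1 hO0 hO2 (annulusValue p hg) ι b

end Literature.NumberTheory.Connes2026
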